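import Literature.MathematicalPhysics.QuantumFieldTheory.Balaban1983to89.B2Eq267HiggsRegion

/-!
# `Balaban1983to89.B2Eq267HiggsRegionAsPrinted` — [Balaban1982Higgs2] Lemma 2.4, proof step **(2.67)** p. 572 ON THE
# (Higgs)₂,₃ CARRIER OF RECORD, its `O((Lᵏε)^κ)` (i) under the field restriction (2.55)₄ AS PRINTED — `|φ(x)| ≤
# (c₁/λ(L^{k−1}ε)^{1/4})p(L^{k−1}ε)`, `λ(ε) = λε^{4−d}` the FUNCTION of p. 557 — for EVERY `d`, and (ii) at EVERY point `y`
# (2.78) p. 574 needs, including the collar of `∂Λ₇^{(k−1)′}` where `□` is only `≳ r(L^{k−1}ε)/L` blocks deep (GAPS G-B2-p23-01)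

statement-level skeleton of published theorems with citation tags; proofs where landed; nothing here is a claim
about the Yang–Mills mass gap

PDF held: `paper:balaban1982-cmp86-higgs23-ii` (journal page = PDF page + 554); pp. 557, 570, 572 [PDF 3, 16, 18] RE-READ AS
IMAGES on the ×2 renders `run/shared/lean/pub/pub-balaban/b2b-balaban-ref1/pages/1982-cmp86-higgs23-II/1982-cmp86-higgs23-II-p003-x2.png`,
`…-p016-x2.png`, `…-p018-x2.png`.

CITATION HEADER (lean-in-tree rule).  T. Bałaban, *(Higgs)₂,₃ quantum fields in a finite volume. II. An upper bound*,
Commun. Math. Phys. **86** (1982) 555–594, doi:10.1007/bf01214890 [Balaban1982Higgs2].  Cell `lit-balaban` (HOME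
`run/shared/lean/pub/lit-balaban/`), Phase-2 proof seat **p23** gen 18 (unit `lit-balaban-p23-g18`); SKELETON row
**B2.Lem2.4** (Lemma 2.4 (2.65)–(2.66) p. 572; owner r02, second reader r14; decl of record `B2.Lemma24Printed`, head UNCHANGED;
this file is a cells-only member).  A NEW LEAF over own `B2Eq267HiggsRegion` (v1 p332428 / v1.1 p334217: the MAIN ESTIMATES
`eq267_higgs_region`, `eq267_deriv_higgs_region`, their tower instances `eq267_higgs_tower`, `eq267_deriv_higgs_tower`, and the
`d = 3`-normal-form corollaries `…_printed`), own `B2Eq2108ErrorBound` v1.3 (p336254: `thrPhi_pFn_nonneg`,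
`printedThreshold_thrPhi_le`), r14's `B2StepK.rDecayBeatsPowers_of_printed` and the typer's `B2LargeField.thrPhi`/`lambdaEps`
(r02) — all used BY NAME; no module is touched; nothing of [B2] is asserted as a fact.  Serves (a) second-reader note
**S-B2-r14g16-1** (r14 gen 16, SECONDREAD-B2 v41: the companions' `_printed` corollaries read (2.55)₄ with `λ` a constant — the
`d = 3` case only) and (b) the second reader's PRECISION under GAPS.md **G-B2-p23-01** (r14 gen 16: for `y` in the collar of
`∂Λ₇^{(k−1)′}` the cube `□ = Bᵏ(□₂)`, `□₂ =` the large blocks of `Λ₆^{(k−1)′}` within `4r(Lᵏε)` of `y` (owner's adopted reading),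
is only `≳ r(L^{k−1}ε)/L ≥ r(Lᵏε)/L` blocks deep around `Bᵏ(y)` — one step-`(k−1)` collar seen from `T₁^{(k)}` — so the
`δG_k(□, Bᵏ(Λ₂′))` factor decays at rate `δ₀/L`, still beating every power).

WHAT IS PRINTED (renders re-read).  p. 572 [PDF 18]: «Let us define □₁, □₂ as the sums of large blocks contained in
Λ₇^{(k−1)′} and distant from the point y less than 2r(Lᵏε), 4r(Lᵏε) respectively, and let us denote □ = Bᵏ(□₂). Of course
□ ⊂ Bᵏ(Λ₂^{(k−1)′}). Using Proposition 2.2 and the restrictions (2.55) we get φ^{(k)}(x) = (a_kG_k(□, A^{(k)})Q_k^*(A^{(k)})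
□₁φ)(x) + O((Lᵏε)^κ), x ∈ Bᵏ(y), (2.67) and the same equality for the covariant derivative of φ^{(k)}.»  p. 570 [PDF 16],
(2.55): «|φ(x)| ≤ (c₁/λ(L^{k−1}ε)^{1/4}) p(L^{k−1}ε) for x ∈ Λ₋₁^{(k−1)′}».  p. 557 [PDF 3], (2.2): «|φ(x)| > (1/(λε^{4−d})^{1/4})
p(ε)», (2.5): «|φ(x)| ≤ (1/λ(ε)^{1/4}) p(ε)», last line «where λ(ε) = λε^{4−d}.»; «p(ε) = b₀(1 + log ε⁻¹)^p, p > 2».  p. 558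
[PDF 4], (2.7): «r(ε) = R(1 + log ε⁻¹)^r … r > 1».

WHAT THIS FILE PROVES (kernel-checked, zero `sorry`; theorems only — no definition, no `Prop` fact; axioms standard).
 §1 **`eq267_higgs_region_pow`** — the `O((Lᵏε)^κ)` of (2.67) from the MAIN ESTIMATE for ANY polynomial field threshold
    `0 ≤ t ≤ T(Lᵏε)^{−m}` and ANY radii coefficients `θ₁, θ₂ > 0`: hypotheses «`(θ₁r(Lᵏε) − s)Lᵏ ≤ dist(x, □ᶜ)`» and
    «`θ₂r(Lᵏε) − s ≤ |x_k − y′|` for `y′ ∈ Λ₆′ ∖ □₁`», conclusion `‖φ^{(k)}(x) − (a_kG_k(□,A)Q_k^*(A)□₁φ)(x)‖ ≤ C′·a_k·(Lᵏε)^κ`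
    (r14's «`e^{−δr(Lᵏε)}` beats every power» at the rates `θ₁δ₀`, `θ₂δ₀`, `δ₀ = 1/(4K₀)`); **`eq267_deriv_higgs_region_pow`** —
    the same for the covariant derivative (one mesh power absorbed at the exponent `κ + 1`).
 §2 under (2.55)₄ AS PRINTED (`|φ| ≤ c₁·p(ℓ/L)/λ(ℓ/L)^{1/4}`, `λ(ε) = λε^{4−d}`, typer's `B2LargeField.thrPhi λ (ℓ/L) d (p(ℓ/L))`,
    `ℓ = Lᵏε`, `d` = the carrier's dimension, `λ > 0`, `c₁ ≥ 0`): **`eq267_higgs_region_collar`** (depth coefficient `θ > 0`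
    free — `θ = 2` is print's `4r/2r` geometry away from `∂Λ₇′`, `θ = 1/L` serves the collar; tail radius `2r(Lᵏε) − s`),
    **`eq267_higgs_region_printed'`** (`θ = 2`: the statement of the companion's `eq267_higgs_region_printed` with the printed
    threshold, every `d`), and the covariant-derivative forms **`eq267_deriv_higgs_region_collar`**, **`eq267_deriv_higgs_region_printed'`**.
 §3 PRINT'S OWN REGIONS `Λ₂^{(k−1)′} ⊇ Λ₆^{(k−1)′}` (the (2.7)–(2.8)/(2.43) tower, cube size `K₀ = M`, as the companion's §6):
    **`eq267_higgs_tower_collar`**, **`eq267_deriv_higgs_tower_collar`** (hence the `θ = 2` printed forms on the tower).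

HONEST SCOPE / DIFFERENCES FROM PRINT.  Exactly the scope of the companion `B2Eq267HiggsRegion` (its (a)–(g): ε-lattice
currency; regions any finite sets of `k`-sites with the inclusions and p35's big-block property, `K₀ ∣ M`, `K₀ ≥ K₀min`;
(I.2.23) regularity assumed on `Bᵏ(Λ₂′)`; `R₀` in site form w.r.t. `□`; constants depending on `K₀`, `θ`, `λ`, `c₁` and the
printed ranges, not optimised; `□₁ ⊆ □₂ ∩ Λ₆′` abstract — the owner's adopted reading of G-B2-p23-01), with two changes only:
the `φ`-threshold is the PRINTED one for every `d` (the companion's `…_printed` = the `d = 3` normal form `cl·(ℓ/L)^{−1/4}p(ℓ/L)`,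
`cl = c₁λ^{−1/4}`; at `d = 2` the printed exponent is `1/2`), and the depth of `x` in `□` carries a free coefficient `θ > 0`
in place of print's `2` (print gives `dist_{T₁^{(k)}}(y, Λ₆′ᶜ) > r(L^{k−1}ε)/L` only for `y` in the collar of `∂Λ₇′`, p. 566
«Λ_i^{(j)} … r(ε) is replaced by r(Lʲε) only» with the (I.1.16) priming; `r(L^{k−1}ε) ≥ r(Lᵏε)`, so `θ = 1/L` serves every `y`
of (2.78)).  `B2.Params` `Q` is a free printed-range record (`Q.L` the `L` of `L^{k−1}ε = (Lᵏε)/L`, as in the companions).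
Nothing about (2.68)–(2.77) or (2.65)–(2.66) on this carrier.  Value = kernel certificate of one printed proof step on the
carrier of record, at `d = 2` as well as `d = 3` and at every point the printed proof uses it; NOT summit progress.
-/

namespace Literature.MathematicalPhysics.QuantumFieldTheory.Balaban1983to89.B2Eq267HiggsRegionAsPrinted

open Literature.MathematicalPhysics.QuantumFieldTheory.Balaban1983to89.HiggsLattice (ChargeData covDeriv)
open Literature.MathematicalPhysics.QuantumFieldTheory.Balaban1983to89.HiggsAveraging (blockIter)
open Literature.MathematicalPhysics.QuantumFieldTheory.Balaban1983to89.B2Eq255Concrete (bgScalar256 underRegion)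
open Literature.MathematicalPhysics.QuantumFieldTheory.Balaban1983to89.B1Ineq234Concrete (distC)
open Literature.MathematicalPhysics.QuantumFieldTheory.Balaban1983to89.B1TorusRegionHSizes (IsBigBlockUnion)
open Literature.MathematicalPhysics.QuantumFieldTheory.Balaban1983to89.B1TorusCubeCover (half)
open Literature.MathematicalPhysics.QuantumFieldTheory.Balaban1983to89.B1TorusCubeLocality26 (rS)
open Literature.MathematicalPhysics.QuantumFieldTheory.Balaban1983to89.B2Eq324NestedRegions (prime)
open Literature.MathematicalPhysics.QuantumFieldTheory.Balaban1983to89.B2Eq243RegionsTower (towerRegion)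
open Literature.MathematicalPhysics.QuantumFieldTheory.Balaban1983to89.B2Eq28RegionsBigBlockUnion (isBigBlockUnion_towerRegion_prime)
open Literature.MathematicalPhysics.QuantumFieldTheory.Balaban1983to89.B2Eq267HiggsRegion (eq267_higgs_region
  eq267_deriv_higgs_region prime_towerRegion_six_subset_two)

noncomputable section

variable {P : HiggsLattice.Params} {N : ℕ}

/-! ## §1. The `O((Lᵏε)^κ)` of (2.67) for any polynomial threshold and any radii coefficients -/

/-- **(2.67), `O((Lᵏε)^κ)` FORM, GENERAL THRESHOLD AND RADII.**  Same data as the companion's `eq267_higgs_region` plus the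
printed parameter ranges `Q.Printed` (`p > 2`, `r > 1`, `L > 1`, `b₀ > 0`, `R > 0`), a threshold scale `T ≥ 0` with an
exponent `m`, radii coefficients `θ₁, θ₂ > 0`, a slack `s` and an exponent `κ`: there are `K₀min` and, per `K₀ ≥ K₀min`,
`e₁ > 0` and `C′` such that — for `|φ| ≤ t` on `Λ₆′` with `0 ≤ t ≤ T(Lᵏε)^{−m}`, `Lᵏε ≤ 1`, «`x` lies at least
`(θ₁r(Lᵏε) − s)Lᵏ` fine steps inside `□`» and «every `y′ ∈ Λ₆′ ∖ □₁` is at least `θ₂r(Lᵏε) − s` coarse steps from `x_k`» —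
`‖φ^{(k)}(x) − (a_kG_k(□,A)Q_k^*(A)□₁φ)(x)‖ ≤ C′·a_k·(Lᵏε)^κ` (the main estimate's two exponentials `e^{−δ₀dist(x,□ᶜ)/Lᵏ}`,
`e^{−δ₀ρ}` at `ρ = θ₂r − s` are `≤ e^{δ₀s}e^{−θᵢδ₀r(Lᵏε)}`, and r14's `rDecayBeatsPowers_of_printed` at the rates `θᵢδ₀`,
`δ₀ = 1/(4K₀)`, absorbs `T(Lᵏε)^{−m}`).  Print's geometry is `θ₁ = θ₂ = 2` (`□₂ ⊇` the blocks within `4r` of `y`, `□₁ =`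
those within `2r`, `x ∈ Bᵏ(y)`). [cite: Balaban1982Higgs2, Lemma 2.4 proof (2.67) p.572 «+ O((Lᵏε)^κ), x ∈ Bᵏ(y)»]
[cite: Balaban1982Higgs2, (2.7) p.558] -/
theorem eq267_higgs_region_pow (d L : ℕ) (hd : 1 ≤ d) (hL : 2 ≤ L) {a : ℝ} (ha : 0 < a) {msq : ℝ} (hmsq : 0 < msq)
    (N : ℕ) (C : ChargeData N) (ε₀ : ℝ) (creg β : ℝ) (hcreg : 0 ≤ creg) (hβ : 0 < β)
    (Q : B2.Params) (hQ : Q.Printed) {T : ℝ} (hT : 0 ≤ T) (m : ℝ) {θ₁ θ₂ : ℝ} (hθ₁ : 0 < θ₁) (hθ₂ : 0 < θ₂)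
    (s κ : ℝ) :
    ∃ K₀min : ℕ, ∀ K₀ : ℕ, K₀min ≤ K₀ → ∃ e₁ : ℝ, 0 < e₁ ∧ ∃ C' : ℝ,
      ∀ (P : HiggsLattice.Params), P.d = d → P.L = L → K₀ ∣ P.M →
      ∀ {k : ℕ}, 1 ≤ k → k ≤ P.K → (∀ μ, 3 * half P k K₀ ≤ P.sitesPerDir 0 μ) → P.mesh k ≤ ε₀ → P.mesh k ≤ 1 →
      ∀ (Λ₂ Λ₆ sq₂ sq₁ : Finset (HiggsLattice.Site P k)), Λ₆ ⊆ Λ₂ → sq₂ ⊆ Λ₂ → sq₁ ⊆ sq₂ → sq₁ ⊆ Λ₆ →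
      IsBigBlockUnion k K₀ (underRegion k Λ₂) → IsBigBlockUnion k K₀ (underRegion k sq₂) →
      ∀ (A : HiggsLattice.VecField P 0) {ec : ℝ}, 0 < ec → ec ≤ e₁ →
      (∀ z ∈ underRegion k Λ₂, ∀ μ ν : Fin P.d,
          P.mesh k * |C.e| / ec * |A ⟨z.shift μ, ν⟩ - A ⟨z, ν⟩| ≤ creg * ec ^ (β - 1) / (P.L : ℝ) ^ k) →
      ∀ (x : HiggsLattice.Site P 0),
        (∀ z, HiggsLattice.Site.tdist x z ≤ 2 * rS P k K₀ + 2 * half P k K₀ * (P.d + 1) + 1 → z ∈ underRegion k sq₂) →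
        (θ₁ * B2.rFn Q.R Q.r (P.mesh k) - s) * (P.L : ℝ) ^ k ≤ distC (underRegion k sq₂) x →
      ∀ (φ : HiggsLattice.ScalarField P k N) (t : ℝ), 0 ≤ t → t ≤ T * P.mesh k ^ (-m) →
        (∀ y ∈ Λ₆, ‖φ y‖ ≤ t) →
        (∀ y ∈ Λ₆, y ∉ sq₁ → θ₂ * B2.rFn Q.R Q.r (P.mesh k) - s ≤ (HiggsLattice.Site.tdist (blockIter k x) y : ℝ)) →
        ‖bgScalar256 C msq a k Λ₂ Λ₆ A φ x - bgScalar256 C msq a k sq₂ sq₁ A φ x‖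
          ≤ C' * B1.aSeq a P.L k * P.mesh k ^ κ := by
  obtain ⟨K₀min, h⟩ := eq267_higgs_region d L hd hL ha hmsq N C ε₀ creg β hcreg hβ
  refine ⟨max K₀min 1, fun K₀ hK₀ => ?_⟩
  obtain ⟨e₁, he₁, C₁, C₂, hC₁, hC₂, h1⟩ := h K₀ ((le_max_left _ _).trans hK₀)
  have hK₀1 : (1 : ℝ) ≤ K₀ := by exact_mod_cast (le_max_right _ _).trans hK₀
  have hδ₀ : (0 : ℝ) < 1 / (4 * K₀) := by positivity
  have hr₁ : (0 : ℝ) < θ₁ * (1 / (4 * K₀)) := by positivity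
  have hr₂ : (0 : ℝ) < θ₂ * (1 / (4 * K₀)) := by positivity
  obtain ⟨D₁, hD₁⟩ := B2StepK.rDecayBeatsPowers_of_printed Q hQ hr₁ (κ + m)
  obtain ⟨D₂, hD₂⟩ := B2StepK.rDecayBeatsPowers_of_printed Q hQ hr₂ (κ + m)
  refine ⟨e₁, he₁, (C₁ * D₁ + C₂ * D₂) * Real.exp (1 / (4 * K₀) * s) * T, ?_⟩
  intro P hPd hPL hK₀M k hk1 hk hsz hε hℓ1 Λ₂ Λ₆ sq₂ sq₁ h62 hs2 hs12 hs16 hΩ hsq A ec hec hle hreg x hx hdist φ t ht0 htT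
    hφ hfar
  set ℓ := P.mesh k with hℓdef
  have hℓ : 0 < ℓ := P.mesh_pos k
  set r := B2.rFn Q.R Q.r ℓ with hrdef
  have hmain := h1 P hPd hPL hK₀M hk1 hk hsz hε Λ₂ Λ₆ sq₂ sq₁ h62 hs2 hs12 hs16 hΩ hsq A hec hle hreg x hx φ t ht0 hφ
    (θ₂ * r - s) hfar
  have hak : 0 ≤ B1.aSeq a P.L k := by
    have hL1' : (1 : ℝ) < P.L := by rw [hPL]; exact_mod_cast hL
    exact (B1.aSeq_pos ha hL1' hk1).le
  have hLk : (0 : ℝ) < (P.L : ℝ) ^ k := pow_pos (by exact_mod_cast P.hL) k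
  have hD : θ₁ * r - s ≤ distC (underRegion k sq₂) x / (P.L : ℝ) ^ k := by
    rw [le_div_iff₀ hLk]; exact hdist
  set Es : ℝ := Real.exp (1 / (4 * K₀) * s) with hEs
  set Er₁ : ℝ := Real.exp (-(θ₁ * (1 / (4 * K₀)) * r)) with hEr₁
  set Er₂ : ℝ := Real.exp (-(θ₂ * (1 / (4 * K₀)) * r)) with hEr₂
  set Ex : ℝ := Real.exp (-(1 / (4 * K₀) * (distC (underRegion k sq₂) x / (P.L : ℝ) ^ k))) with hEx
  set Eρ : ℝ := Real.exp (-(1 / (4 * K₀) * (θ₂ * r - s))) with hEρ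
  have hE1 : Ex ≤ Es * Er₁ := by
    rw [hEx, hEs, hEr₁, ← Real.exp_add]
    exact Real.exp_le_exp.2 (by nlinarith [hδ₀.le])
  have hE2 : Eρ = Es * Er₂ := by
    rw [hEρ, hEs, hEr₂, ← Real.exp_add]; congr 1; ring
  have hdec₁ : Er₁ ≤ D₁ * ℓ ^ (κ + m) := hD₁ ℓ hℓ hℓ1
  have hdec₂ : Er₂ ≤ D₂ * ℓ ^ (κ + m) := hD₂ ℓ hℓ hℓ1
  have hpow : ℓ ^ (-m) * ℓ ^ (κ + m) = ℓ ^ κ := by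
    rw [← Real.rpow_add hℓ]; ring_nf
  have hEs0 : 0 ≤ Es := Real.exp_nonneg _
  have hsum0 : 0 ≤ C₁ * Ex + C₂ * Eρ :=
    add_nonneg (mul_nonneg hC₁ (Real.exp_nonneg _)) (mul_nonneg hC₂ (Real.exp_nonneg _))
  have hTm : 0 ≤ T * ℓ ^ (-m) := mul_nonneg hT (Real.rpow_nonneg hℓ.le _)
  calc ‖bgScalar256 C msq a k Λ₂ Λ₆ A φ x - bgScalar256 C msq a k sq₂ sq₁ A φ x‖
      ≤ B1.aSeq a P.L k * t * (C₁ * Ex + C₂ * Eρ) := hmain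
    _ ≤ B1.aSeq a P.L k * (T * ℓ ^ (-m)) * (C₁ * Ex + C₂ * Eρ) :=
        mul_le_mul_of_nonneg_right (mul_le_mul_of_nonneg_left htT hak) hsum0
    _ ≤ B1.aSeq a P.L k * (T * ℓ ^ (-m)) * (C₁ * (Es * (D₁ * ℓ ^ (κ + m))) + C₂ * (Es * (D₂ * ℓ ^ (κ + m)))) := by
        refine mul_le_mul_of_nonneg_left (add_le_add ?_ ?_) (mul_nonneg hak hTm)
        · exact mul_le_mul_of_nonneg_left (hE1.trans (mul_le_mul_of_nonneg_left hdec₁ hEs0)) hC₁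
        · rw [hE2]; exact mul_le_mul_of_nonneg_left (mul_le_mul_of_nonneg_left hdec₂ hEs0) hC₂
    _ = (C₁ * D₁ + C₂ * D₂) * Es * T * B1.aSeq a P.L k * (ℓ ^ (-m) * ℓ ^ (κ + m)) := by ring
    _ = (C₁ * D₁ + C₂ * D₂) * Real.exp (1 / (4 * K₀) * s) * T * B1.aSeq a P.L k * P.mesh k ^ κ := by rw [hpow]

/-- **(2.67), COVARIANT-DERIVATIVE FORM, `O((Lᵏε)^κ)`, GENERAL THRESHOLD AND RADII**: as `eq267_higgs_region_pow`, for the bond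
`⟨x, x + εe_μ⟩` — `‖(D^ε_Aφ^{(k)})(⟨x,μ⟩) − (D^ε_A a_kG_k(□,A)Q_k^*(A)□₁φ)(⟨x,μ⟩)‖ ≤ C′·a_k·(Lᵏε)^κ` (the mesh power `(Lᵏε)^{−1}`
of the derivative form absorbed at the exponent `κ + 1`).
[cite: Balaban1982Higgs2, Lemma 2.4 proof (2.67) p.572 «and the same equality for the covariant derivative of φ^{(k)}»]
[cite: Balaban1982Higgs2, (2.7) p.558] -/
theorem eq267_deriv_higgs_region_pow (d L : ℕ) (hd : 1 ≤ d) (hL : 2 ≤ L) {a : ℝ} (ha : 0 < a) {msq : ℝ}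
    (hmsq : 0 < msq) (N : ℕ) (C : ChargeData N) (ε₀ : ℝ) (creg β : ℝ) (hcreg : 0 ≤ creg) (hβ : 0 < β)
    (Q : B2.Params) (hQ : Q.Printed) {T : ℝ} (hT : 0 ≤ T) (m : ℝ) {θ₁ θ₂ : ℝ} (hθ₁ : 0 < θ₁) (hθ₂ : 0 < θ₂)
    (s κ : ℝ) :
    ∃ K₀min : ℕ, ∀ K₀ : ℕ, K₀min ≤ K₀ → ∃ e₁ : ℝ, 0 < e₁ ∧ ∃ C' : ℝ,
      ∀ (P : HiggsLattice.Params), P.d = d → P.L = L → K₀ ∣ P.M →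
      ∀ {k : ℕ}, 1 ≤ k → k ≤ P.K → (∀ μ, 3 * half P k K₀ ≤ P.sitesPerDir 0 μ) → P.mesh k ≤ ε₀ → P.mesh k ≤ 1 →
      ∀ (Λ₂ Λ₆ sq₂ sq₁ : Finset (HiggsLattice.Site P k)), Λ₆ ⊆ Λ₂ → sq₂ ⊆ Λ₂ → sq₁ ⊆ sq₂ → sq₁ ⊆ Λ₆ →
      IsBigBlockUnion k K₀ (underRegion k Λ₂) → IsBigBlockUnion k K₀ (underRegion k sq₂) →
      ∀ (A : HiggsLattice.VecField P 0) {ec : ℝ}, 0 < ec → ec ≤ e₁ →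
      (∀ z ∈ underRegion k Λ₂, ∀ μ ν : Fin P.d,
          P.mesh k * |C.e| / ec * |A ⟨z.shift μ, ν⟩ - A ⟨z, ν⟩| ≤ creg * ec ^ (β - 1) / (P.L : ℝ) ^ k) →
      ∀ (x : HiggsLattice.Site P 0) (μ : Fin P.d),
        (∀ z, HiggsLattice.Site.tdist x z ≤ 2 * rS P k K₀ + 2 * half P k K₀ * (P.d + 1) + 1 → z ∈ underRegion k sq₂) →
        (θ₁ * B2.rFn Q.R Q.r (P.mesh k) - s) * (P.L : ℝ) ^ k ≤ distC (underRegion k sq₂) x →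
      ∀ (φ : HiggsLattice.ScalarField P k N) (t : ℝ), 0 ≤ t → t ≤ T * P.mesh k ^ (-m) →
        (∀ y ∈ Λ₆, ‖φ y‖ ≤ t) →
        (∀ y ∈ Λ₆, y ∉ sq₁ → θ₂ * B2.rFn Q.R Q.r (P.mesh k) - s ≤ (HiggsLattice.Site.tdist (blockIter k x) y : ℝ)) →
        ‖covDeriv C A (bgScalar256 C msq a k Λ₂ Λ₆ A φ) ⟨x, μ⟩ - covDeriv C A (bgScalar256 C msq a k sq₂ sq₁ A φ) ⟨x, μ⟩‖
          ≤ C' * B1.aSeq a P.L k * P.mesh k ^ κ := by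
  obtain ⟨K₀min, h⟩ := eq267_deriv_higgs_region d L hd hL ha hmsq N C ε₀ creg β hcreg hβ
  refine ⟨max K₀min 1, fun K₀ hK₀ => ?_⟩
  obtain ⟨e₁, he₁, C₁, C₂, hC₁, hC₂, h1⟩ := h K₀ ((le_max_left _ _).trans hK₀)
  have hK₀1 : (1 : ℝ) ≤ K₀ := by exact_mod_cast (le_max_right _ _).trans hK₀
  have hδ₀ : (0 : ℝ) < 1 / (4 * K₀) := by positivity
  have hr₁ : (0 : ℝ) < θ₁ * (1 / (4 * K₀)) := by positivity
  have hr₂ : (0 : ℝ) < θ₂ * (1 / (4 * K₀)) := by positivity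
  obtain ⟨D₁, hD₁⟩ := B2StepK.rDecayBeatsPowers_of_printed Q hQ hr₁ (κ + 1 + m)
  obtain ⟨D₂, hD₂⟩ := B2StepK.rDecayBeatsPowers_of_printed Q hQ hr₂ (κ + 1 + m)
  refine ⟨e₁, he₁, (C₁ * D₁ + C₂ * D₂) * Real.exp (1 / (4 * K₀) * s) * T, ?_⟩
  intro P hPd hPL hK₀M k hk1 hk hsz hε hℓ1 Λ₂ Λ₆ sq₂ sq₁ h62 hs2 hs12 hs16 hΩ hsq A ec hec hle hreg x μ hx hdist φ t ht0 htT
    hφ hfar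
  set ℓ := P.mesh k with hℓdef
  have hℓ : 0 < ℓ := P.mesh_pos k
  set r := B2.rFn Q.R Q.r ℓ with hrdef
  have hmain := h1 P hPd hPL hK₀M hk1 hk hsz hε Λ₂ Λ₆ sq₂ sq₁ h62 hs2 hs12 hs16 hΩ hsq A hec hle hreg x μ hx φ t ht0 hφ
    (θ₂ * r - s) hfar
  have hak : 0 ≤ B1.aSeq a P.L k := by
    have hL1' : (1 : ℝ) < P.L := by rw [hPL]; exact_mod_cast hL
    exact (B1.aSeq_pos ha hL1' hk1).le
  have hLk : (0 : ℝ) < (P.L : ℝ) ^ k := pow_pos (by exact_mod_cast P.hL) k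
  have hD : θ₁ * r - s ≤ distC (underRegion k sq₂) x / (P.L : ℝ) ^ k := by
    rw [le_div_iff₀ hLk]; exact hdist
  set Es : ℝ := Real.exp (1 / (4 * K₀) * s) with hEs
  set Er₁ : ℝ := Real.exp (-(θ₁ * (1 / (4 * K₀)) * r)) with hEr₁
  set Er₂ : ℝ := Real.exp (-(θ₂ * (1 / (4 * K₀)) * r)) with hEr₂
  set Ex : ℝ := Real.exp (-(1 / (4 * K₀) * (distC (underRegion k sq₂) x / (P.L : ℝ) ^ k))) with hEx
  set Eρ : ℝ := Real.exp (-(1 / (4 * K₀) * (θ₂ * r - s))) with hEρ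
  have hE1 : Ex ≤ Es * Er₁ := by
    rw [hEx, hEs, hEr₁, ← Real.exp_add]
    exact Real.exp_le_exp.2 (by nlinarith [hδ₀.le])
  have hE2 : Eρ = Es * Er₂ := by
    rw [hEρ, hEs, hEr₂, ← Real.exp_add]; congr 1; ring
  have hdec₁ : Er₁ ≤ D₁ * ℓ ^ (κ + 1 + m) := hD₁ ℓ hℓ hℓ1
  have hdec₂ : Er₂ ≤ D₂ * ℓ ^ (κ + 1 + m) := hD₂ ℓ hℓ hℓ1
  have hpow : ℓ⁻¹ * (ℓ ^ (-m) * ℓ ^ (κ + 1 + m)) = ℓ ^ κ := by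
    rw [← Real.rpow_neg_one ℓ, ← Real.rpow_add hℓ, ← Real.rpow_add hℓ]; ring_nf
  have hEs0 : 0 ≤ Es := Real.exp_nonneg _
  have hsum0 : 0 ≤ C₁ * Ex + C₂ * Eρ :=
    add_nonneg (mul_nonneg hC₁ (Real.exp_nonneg _)) (mul_nonneg hC₂ (Real.exp_nonneg _))
  have hℓi : 0 ≤ ℓ⁻¹ := inv_nonneg.2 hℓ.le
  have hTm : 0 ≤ T * ℓ ^ (-m) := mul_nonneg hT (Real.rpow_nonneg hℓ.le _)
  calc ‖covDeriv C A (bgScalar256 C msq a k Λ₂ Λ₆ A φ) ⟨x, μ⟩ - covDeriv C A (bgScalar256 C msq a k sq₂ sq₁ A φ) ⟨x, μ⟩‖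
      ≤ B1.aSeq a P.L k * ℓ⁻¹ * t * (C₁ * Ex + C₂ * Eρ) := hmain
    _ ≤ B1.aSeq a P.L k * ℓ⁻¹ * (T * ℓ ^ (-m)) * (C₁ * Ex + C₂ * Eρ) :=
        mul_le_mul_of_nonneg_right (mul_le_mul_of_nonneg_left htT (mul_nonneg hak hℓi)) hsum0
    _ ≤ B1.aSeq a P.L k * ℓ⁻¹ * (T * ℓ ^ (-m)) *
          (C₁ * (Es * (D₁ * ℓ ^ (κ + 1 + m))) + C₂ * (Es * (D₂ * ℓ ^ (κ + 1 + m)))) := by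
        refine mul_le_mul_of_nonneg_left (add_le_add ?_ ?_) (mul_nonneg (mul_nonneg hak hℓi) hTm)
        · exact mul_le_mul_of_nonneg_left (hE1.trans (mul_le_mul_of_nonneg_left hdec₁ hEs0)) hC₁
        · rw [hE2]; exact mul_le_mul_of_nonneg_left (mul_le_mul_of_nonneg_left hdec₂ hEs0) hC₂
    _ = (C₁ * D₁ + C₂ * D₂) * Es * T * B1.aSeq a P.L k * (ℓ⁻¹ * (ℓ ^ (-m) * ℓ ^ (κ + 1 + m))) := by ring
    _ = (C₁ * D₁ + C₂ * D₂) * Real.exp (1 / (4 * K₀) * s) * T * B1.aSeq a P.L k * P.mesh k ^ κ := by rw [hpow]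

/-! ## §2. Under (2.55)₄ AS PRINTED, every `d`; the collar of `∂Λ₇′` (depth coefficient `θ`) -/

/-- **(2.67) AS PRINTED, EVERY `d`, AT EVERY POINT OF (2.78) — the `∂Λ₇′`-collar form.**  Same data as `eq267_higgs_region`
plus `Q.Printed`, `λ > 0`, `c₁ ≥ 0`, a depth coefficient `θ > 0`, a slack `s`, an exponent `κ`: there are `K₀min` and, per
`K₀ ≥ K₀min`, `e₁ > 0` and `C′` such that — under (2.55)₄ `|φ(y′)| ≤ (c₁/λ(L^{k−1}ε)^{1/4})p(L^{k−1}ε)` on `Λ₆′` with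
`λ(ε) = λε^{4−d}` (typer's `B2LargeField.thrPhi λ ((Lᵏε)/L) d (p((Lᵏε)/L))`, `d` = the carrier's dimension), `Lᵏε ≤ 1`,
«`x` lies at least `(θr(Lᵏε) − s)Lᵏ` fine steps inside `□`» and «every `y′ ∈ Λ₆′ ∖ □₁` is at least `2r(Lᵏε) − s` coarse
steps from `x_k`» — `‖φ^{(k)}(x) − (a_kG_k(□,A)Q_k^*(A)□₁φ)(x)‖ ≤ C′·a_k·(Lᵏε)^κ`.  `θ = 2` is print's geometry for `y` away
from `∂Λ₇′` (`□₂ ⊇` the blocks within `4r(Lᵏε)` of `y`); for `y` in the collar of `∂Λ₇′` (owner's reading of G-B2-p23-01: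
`□₂ =` the large blocks of `Λ₆′` within `4r` of `y`) print gives only `dist(y, Λ₆′ᶜ) > r(L^{k−1}ε)/L ≥ r(Lᵏε)/L`, served by
`θ = 1/L` (second reader's precision, rate `δ₀/L`). [cite: Balaban1982Higgs2, Lemma 2.4 proof (2.67) p.572, (2.78) p.574]
[cite: Balaban1982Higgs2, (2.55) p.570, (2.2)/(2.5) p.557, (2.7)–(2.8) p.558, p.566] -/
theorem eq267_higgs_region_collar (d L : ℕ) (hd : 1 ≤ d) (hL : 2 ≤ L) {a : ℝ} (ha : 0 < a) {msq : ℝ} (hmsq : 0 < msq)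
    (N : ℕ) (C : ChargeData N) (ε₀ : ℝ) (creg β : ℝ) (hcreg : 0 ≤ creg) (hβ : 0 < β)
    (Q : B2.Params) (hQ : Q.Printed) {lam c₁ : ℝ} (hlam : 0 < lam) (hc₁ : 0 ≤ c₁) {θ : ℝ} (hθ : 0 < θ) (s κ : ℝ) :
    ∃ K₀min : ℕ, ∀ K₀ : ℕ, K₀min ≤ K₀ → ∃ e₁ : ℝ, 0 < e₁ ∧ ∃ C' : ℝ,
      ∀ (P : HiggsLattice.Params), P.d = d → P.L = L → K₀ ∣ P.M →
      ∀ {k : ℕ}, 1 ≤ k → k ≤ P.K → (∀ μ, 3 * half P k K₀ ≤ P.sitesPerDir 0 μ) → P.mesh k ≤ ε₀ → P.mesh k ≤ 1 →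
      ∀ (Λ₂ Λ₆ sq₂ sq₁ : Finset (HiggsLattice.Site P k)), Λ₆ ⊆ Λ₂ → sq₂ ⊆ Λ₂ → sq₁ ⊆ sq₂ → sq₁ ⊆ Λ₆ →
      IsBigBlockUnion k K₀ (underRegion k Λ₂) → IsBigBlockUnion k K₀ (underRegion k sq₂) →
      ∀ (A : HiggsLattice.VecField P 0) {ec : ℝ}, 0 < ec → ec ≤ e₁ →
      (∀ z ∈ underRegion k Λ₂, ∀ μ ν : Fin P.d,
          P.mesh k * |C.e| / ec * |A ⟨z.shift μ, ν⟩ - A ⟨z, ν⟩| ≤ creg * ec ^ (β - 1) / (P.L : ℝ) ^ k) →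
      ∀ (x : HiggsLattice.Site P 0),
        (∀ z, HiggsLattice.Site.tdist x z ≤ 2 * rS P k K₀ + 2 * half P k K₀ * (P.d + 1) + 1 → z ∈ underRegion k sq₂) →
        (θ * B2.rFn Q.R Q.r (P.mesh k) - s) * (P.L : ℝ) ^ k ≤ distC (underRegion k sq₂) x →
      ∀ (φ : HiggsLattice.ScalarField P k N),
        (∀ y ∈ Λ₆, ‖φ y‖ ≤ c₁ * B2LargeField.thrPhi lam (P.mesh k / Q.L) d (B2.pFn Q.b₀ Q.p (P.mesh k / Q.L))) →
        (∀ y ∈ Λ₆, y ∉ sq₁ → 2 * B2.rFn Q.R Q.r (P.mesh k) - s ≤ (HiggsLattice.Site.tdist (blockIter k x) y : ℝ)) →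
        ‖bgScalar256 C msq a k Λ₂ Λ₆ A φ x - bgScalar256 C msq a k sq₂ sq₁ A φ x‖
          ≤ C' * B1.aSeq a P.L k * P.mesh k ^ κ := by
  obtain ⟨hp2, -, hL1, -, -, -, hb0, -⟩ := id hQ
  have hT : 0 ≤ c₁ * lam ^ (-(1 / 4 : ℝ)) * Q.b₀ * (Q.L : ℝ) ^ (((4 : ℝ) - d) / 4 + Q.p) :=
    mul_nonneg (mul_nonneg (mul_nonneg hc₁ (Real.rpow_nonneg hlam.le _)) hb0.le)
      (Real.rpow_nonneg (Nat.cast_nonneg _) _)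
  obtain ⟨K₀min, h⟩ := eq267_higgs_region_pow d L hd hL ha hmsq N C ε₀ creg β hcreg hβ Q hQ hT
    (((4 : ℝ) - d) / 4 + Q.p) hθ (two_pos : (0 : ℝ) < 2) s κ
  refine ⟨K₀min, fun K₀ hK₀ => ?_⟩
  obtain ⟨e₁, he₁, C', h1⟩ := h K₀ hK₀
  refine ⟨e₁, he₁, C', ?_⟩
  intro P hPd hPL hK₀M k hk1 hk hsz hε hℓ1 Λ₂ Λ₆ sq₂ sq₁ h62 hs2 hs12 hs16 hΩ hsq A ec hec hle hreg x hx hdist φ hφ hfar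
  have hQL : (1 : ℝ) ≤ Q.L := by exact_mod_cast hL1.le
  have hℓ : 0 < P.mesh k := P.mesh_pos k
  have hx1 : P.mesh k / Q.L ≤ 1 := by rw [div_le_one (by linarith)]; linarith
  exact h1 P hPd hPL hK₀M hk1 hk hsz hε hℓ1 Λ₂ Λ₆ sq₂ sq₁ h62 hs2 hs12 hs16 hΩ hsq A hec hle hreg x hx hdist φ _
    (B2Eq2108ErrorBound.thrPhi_pFn_nonneg hlam hc₁ hb0.le (div_pos hℓ (by linarith)) hx1 d)
    (B2Eq2108ErrorBound.printedThreshold_thrPhi_le hlam hc₁ hb0.le (by linarith) hQL hℓ hℓ1 d) hφ hfar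

/-- **(2.67) AS PRINTED — `φ^{(k)}(x) = (a_kG_k(□, A^{(k)})Q_k^*(A^{(k)})□₁φ)(x) + O((Lᵏε)^κ)` — UNDER (2.55)₄ AS PRINTED, EVERY
`d`.**  The statement of the companion's `eq267_higgs_region_printed` with the field threshold replaced by the printed one,
`|φ(y′)| ≤ (c₁/λ(L^{k−1}ε)^{1/4})p(L^{k−1}ε)`, `λ(ε) = λε^{4−d}` (typer's `B2LargeField.thrPhi`; the companion's hypothesis
`cl·((Lᵏε)/L)^{−1/4}p((Lᵏε)/L)` is the `d = 3` normal form, `cl = c₁λ^{−1/4}`; at `d = 2` the exponent is `1/2`): print's radii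
«`(2r(Lᵏε) − s)Lᵏ ≤ dist(x, □ᶜ)`», «`2r(Lᵏε) − s ≤ |x_k − y′|` off `□₁`», conclusion `≤ C′·a_k·(Lᵏε)^κ` (`eq267_higgs_region_collar`
at `θ = 2`). [cite: Balaban1982Higgs2, Lemma 2.4 proof (2.67) p.572 «+ O((Lᵏε)^κ), x ∈ Bᵏ(y)»]
[cite: Balaban1982Higgs2, (2.55) p.570, (2.2)/(2.5) p.557, (2.7) p.558] -/
theorem eq267_higgs_region_printed' (d L : ℕ) (hd : 1 ≤ d) (hL : 2 ≤ L) {a : ℝ} (ha : 0 < a) {msq : ℝ} (hmsq : 0 < msq)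
    (N : ℕ) (C : ChargeData N) (ε₀ : ℝ) (creg β : ℝ) (hcreg : 0 ≤ creg) (hβ : 0 < β)
    (Q : B2.Params) (hQ : Q.Printed) {lam c₁ : ℝ} (hlam : 0 < lam) (hc₁ : 0 ≤ c₁) (s κ : ℝ) :
    ∃ K₀min : ℕ, ∀ K₀ : ℕ, K₀min ≤ K₀ → ∃ e₁ : ℝ, 0 < e₁ ∧ ∃ C' : ℝ,
      ∀ (P : HiggsLattice.Params), P.d = d → P.L = L → K₀ ∣ P.M →
      ∀ {k : ℕ}, 1 ≤ k → k ≤ P.K → (∀ μ, 3 * half P k K₀ ≤ P.sitesPerDir 0 μ) → P.mesh k ≤ ε₀ → P.mesh k ≤ 1 →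
      ∀ (Λ₂ Λ₆ sq₂ sq₁ : Finset (HiggsLattice.Site P k)), Λ₆ ⊆ Λ₂ → sq₂ ⊆ Λ₂ → sq₁ ⊆ sq₂ → sq₁ ⊆ Λ₆ →
      IsBigBlockUnion k K₀ (underRegion k Λ₂) → IsBigBlockUnion k K₀ (underRegion k sq₂) →
      ∀ (A : HiggsLattice.VecField P 0) {ec : ℝ}, 0 < ec → ec ≤ e₁ →
      (∀ z ∈ underRegion k Λ₂, ∀ μ ν : Fin P.d,
          P.mesh k * |C.e| / ec * |A ⟨z.shift μ, ν⟩ - A ⟨z, ν⟩| ≤ creg * ec ^ (β - 1) / (P.L : ℝ) ^ k) →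
      ∀ (x : HiggsLattice.Site P 0),
        (∀ z, HiggsLattice.Site.tdist x z ≤ 2 * rS P k K₀ + 2 * half P k K₀ * (P.d + 1) + 1 → z ∈ underRegion k sq₂) →
        (2 * B2.rFn Q.R Q.r (P.mesh k) - s) * (P.L : ℝ) ^ k ≤ distC (underRegion k sq₂) x →
      ∀ (φ : HiggsLattice.ScalarField P k N),
        (∀ y ∈ Λ₆, ‖φ y‖ ≤ c₁ * B2LargeField.thrPhi lam (P.mesh k / Q.L) d (B2.pFn Q.b₀ Q.p (P.mesh k / Q.L))) →
        (∀ y ∈ Λ₆, y ∉ sq₁ → 2 * B2.rFn Q.R Q.r (P.mesh k) - s ≤ (HiggsLattice.Site.tdist (blockIter k x) y : ℝ)) →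
        ‖bgScalar256 C msq a k Λ₂ Λ₆ A φ x - bgScalar256 C msq a k sq₂ sq₁ A φ x‖
          ≤ C' * B1.aSeq a P.L k * P.mesh k ^ κ :=
  eq267_higgs_region_collar d L hd hL ha hmsq N C ε₀ creg β hcreg hβ Q hQ hlam hc₁ (two_pos : (0 : ℝ) < 2) s κ

/-- **(2.67), COVARIANT-DERIVATIVE FORM, AS PRINTED, EVERY `d`, AT EVERY POINT OF (2.78) — the `∂Λ₇′`-collar form**: as
`eq267_higgs_region_collar`, for the bond `⟨x, x + εe_μ⟩`: `‖(D^ε_Aφ^{(k)})(⟨x,μ⟩) − (D^ε_A a_kG_k(□,A)Q_k^*(A)□₁φ)(⟨x,μ⟩)‖ ≤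
C′·a_k·(Lᵏε)^κ` under (2.55)₄ as printed, depth coefficient `θ > 0`, tail radius `2r(Lᵏε) − s`.
[cite: Balaban1982Higgs2, Lemma 2.4 proof (2.67) p.572 «and the same equality for the covariant derivative of φ^{(k)}», (2.78) p.574]
[cite: Balaban1982Higgs2, (2.55) p.570, (2.2)/(2.5) p.557, (2.7)–(2.8) p.558] -/
theorem eq267_deriv_higgs_region_collar (d L : ℕ) (hd : 1 ≤ d) (hL : 2 ≤ L) {a : ℝ} (ha : 0 < a) {msq : ℝ}
    (hmsq : 0 < msq) (N : ℕ) (C : ChargeData N) (ε₀ : ℝ) (creg β : ℝ) (hcreg : 0 ≤ creg) (hβ : 0 < β)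
    (Q : B2.Params) (hQ : Q.Printed) {lam c₁ : ℝ} (hlam : 0 < lam) (hc₁ : 0 ≤ c₁) {θ : ℝ} (hθ : 0 < θ) (s κ : ℝ) :
    ∃ K₀min : ℕ, ∀ K₀ : ℕ, K₀min ≤ K₀ → ∃ e₁ : ℝ, 0 < e₁ ∧ ∃ C' : ℝ,
      ∀ (P : HiggsLattice.Params), P.d = d → P.L = L → K₀ ∣ P.M →
      ∀ {k : ℕ}, 1 ≤ k → k ≤ P.K → (∀ μ, 3 * half P k K₀ ≤ P.sitesPerDir 0 μ) → P.mesh k ≤ ε₀ → P.mesh k ≤ 1 →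
      ∀ (Λ₂ Λ₆ sq₂ sq₁ : Finset (HiggsLattice.Site P k)), Λ₆ ⊆ Λ₂ → sq₂ ⊆ Λ₂ → sq₁ ⊆ sq₂ → sq₁ ⊆ Λ₆ →
      IsBigBlockUnion k K₀ (underRegion k Λ₂) → IsBigBlockUnion k K₀ (underRegion k sq₂) →
      ∀ (A : HiggsLattice.VecField P 0) {ec : ℝ}, 0 < ec → ec ≤ e₁ →
      (∀ z ∈ underRegion k Λ₂, ∀ μ ν : Fin P.d,
          P.mesh k * |C.e| / ec * |A ⟨z.shift μ, ν⟩ - A ⟨z, ν⟩| ≤ creg * ec ^ (β - 1) / (P.L : ℝ) ^ k) →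
      ∀ (x : HiggsLattice.Site P 0) (μ : Fin P.d),
        (∀ z, HiggsLattice.Site.tdist x z ≤ 2 * rS P k K₀ + 2 * half P k K₀ * (P.d + 1) + 1 → z ∈ underRegion k sq₂) →
        (θ * B2.rFn Q.R Q.r (P.mesh k) - s) * (P.L : ℝ) ^ k ≤ distC (underRegion k sq₂) x →
      ∀ (φ : HiggsLattice.ScalarField P k N),
        (∀ y ∈ Λ₆, ‖φ y‖ ≤ c₁ * B2LargeField.thrPhi lam (P.mesh k / Q.L) d (B2.pFn Q.b₀ Q.p (P.mesh k / Q.L))) →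
        (∀ y ∈ Λ₆, y ∉ sq₁ → 2 * B2.rFn Q.R Q.r (P.mesh k) - s ≤ (HiggsLattice.Site.tdist (blockIter k x) y : ℝ)) →
        ‖covDeriv C A (bgScalar256 C msq a k Λ₂ Λ₆ A φ) ⟨x, μ⟩ - covDeriv C A (bgScalar256 C msq a k sq₂ sq₁ A φ) ⟨x, μ⟩‖
          ≤ C' * B1.aSeq a P.L k * P.mesh k ^ κ := by
  obtain ⟨hp2, -, hL1, -, -, -, hb0, -⟩ := id hQ
  have hT : 0 ≤ c₁ * lam ^ (-(1 / 4 : ℝ)) * Q.b₀ * (Q.L : ℝ) ^ (((4 : ℝ) - d) / 4 + Q.p) :=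
    mul_nonneg (mul_nonneg (mul_nonneg hc₁ (Real.rpow_nonneg hlam.le _)) hb0.le)
      (Real.rpow_nonneg (Nat.cast_nonneg _) _)
  obtain ⟨K₀min, h⟩ := eq267_deriv_higgs_region_pow d L hd hL ha hmsq N C ε₀ creg β hcreg hβ Q hQ hT
    (((4 : ℝ) - d) / 4 + Q.p) hθ (two_pos : (0 : ℝ) < 2) s κ
  refine ⟨K₀min, fun K₀ hK₀ => ?_⟩
  obtain ⟨e₁, he₁, C', h1⟩ := h K₀ hK₀
  refine ⟨e₁, he₁, C', ?_⟩
  intro P hPd hPL hK₀M k hk1 hk hsz hε hℓ1 Λ₂ Λ₆ sq₂ sq₁ h62 hs2 hs12 hs16 hΩ hsq A ec hec hle hreg x μ hx hdist φ hφ hfar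
  have hQL : (1 : ℝ) ≤ Q.L := by exact_mod_cast hL1.le
  have hℓ : 0 < P.mesh k := P.mesh_pos k
  have hx1 : P.mesh k / Q.L ≤ 1 := by rw [div_le_one (by linarith)]; linarith
  exact h1 P hPd hPL hK₀M hk1 hk hsz hε hℓ1 Λ₂ Λ₆ sq₂ sq₁ h62 hs2 hs12 hs16 hΩ hsq A hec hle hreg x μ hx hdist φ _
    (B2Eq2108ErrorBound.thrPhi_pFn_nonneg hlam hc₁ hb0.le (div_pos hℓ (by linarith)) hx1 d)
    (B2Eq2108ErrorBound.printedThreshold_thrPhi_le hlam hc₁ hb0.le (by linarith) hQL hℓ hℓ1 d) hφ hfar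

/-- **(2.67), COVARIANT-DERIVATIVE FORM, AS PRINTED, EVERY `d`**: the statement of the companion's
`eq267_deriv_higgs_region_printed` with the printed threshold (`eq267_deriv_higgs_region_collar` at `θ = 2`).
[cite: Balaban1982Higgs2, Lemma 2.4 proof (2.67) p.572 «and the same equality for the covariant derivative of φ^{(k)}»]
[cite: Balaban1982Higgs2, (2.55) p.570, (2.2)/(2.5) p.557, (2.7) p.558] -/
theorem eq267_deriv_higgs_region_printed' (d L : ℕ) (hd : 1 ≤ d) (hL : 2 ≤ L) {a : ℝ} (ha : 0 < a) {msq : ℝ}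
    (hmsq : 0 < msq) (N : ℕ) (C : ChargeData N) (ε₀ : ℝ) (creg β : ℝ) (hcreg : 0 ≤ creg) (hβ : 0 < β)
    (Q : B2.Params) (hQ : Q.Printed) {lam c₁ : ℝ} (hlam : 0 < lam) (hc₁ : 0 ≤ c₁) (s κ : ℝ) :
    ∃ K₀min : ℕ, ∀ K₀ : ℕ, K₀min ≤ K₀ → ∃ e₁ : ℝ, 0 < e₁ ∧ ∃ C' : ℝ,
      ∀ (P : HiggsLattice.Params), P.d = d → P.L = L → K₀ ∣ P.M →
      ∀ {k : ℕ}, 1 ≤ k → k ≤ P.K → (∀ μ, 3 * half P k K₀ ≤ P.sitesPerDir 0 μ) → P.mesh k ≤ ε₀ → P.mesh k ≤ 1 →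
      ∀ (Λ₂ Λ₆ sq₂ sq₁ : Finset (HiggsLattice.Site P k)), Λ₆ ⊆ Λ₂ → sq₂ ⊆ Λ₂ → sq₁ ⊆ sq₂ → sq₁ ⊆ Λ₆ →
      IsBigBlockUnion k K₀ (underRegion k Λ₂) → IsBigBlockUnion k K₀ (underRegion k sq₂) →
      ∀ (A : HiggsLattice.VecField P 0) {ec : ℝ}, 0 < ec → ec ≤ e₁ →
      (∀ z ∈ underRegion k Λ₂, ∀ μ ν : Fin P.d,
          P.mesh k * |C.e| / ec * |A ⟨z.shift μ, ν⟩ - A ⟨z, ν⟩| ≤ creg * ec ^ (β - 1) / (P.L : ℝ) ^ k) →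
      ∀ (x : HiggsLattice.Site P 0) (μ : Fin P.d),
        (∀ z, HiggsLattice.Site.tdist x z ≤ 2 * rS P k K₀ + 2 * half P k K₀ * (P.d + 1) + 1 → z ∈ underRegion k sq₂) →
        (2 * B2.rFn Q.R Q.r (P.mesh k) - s) * (P.L : ℝ) ^ k ≤ distC (underRegion k sq₂) x →
      ∀ (φ : HiggsLattice.ScalarField P k N),
        (∀ y ∈ Λ₆, ‖φ y‖ ≤ c₁ * B2LargeField.thrPhi lam (P.mesh k / Q.L) d (B2.pFn Q.b₀ Q.p (P.mesh k / Q.L))) →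
        (∀ y ∈ Λ₆, y ∉ sq₁ → 2 * B2.rFn Q.R Q.r (P.mesh k) - s ≤ (HiggsLattice.Site.tdist (blockIter k x) y : ℝ)) →
        ‖covDeriv C A (bgScalar256 C msq a k Λ₂ Λ₆ A φ) ⟨x, μ⟩ - covDeriv C A (bgScalar256 C msq a k sq₂ sq₁ A φ) ⟨x, μ⟩‖
          ≤ C' * B1.aSeq a P.L k * P.mesh k ^ κ :=
  eq267_deriv_higgs_region_collar d L hd hL ha hmsq N C ε₀ creg β hcreg hβ Q hQ hlam hc₁ (two_pos : (0 : ℝ) < 2) s κ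

/-! ## §3. Print's own regions `Λ₂^{(k−1)′} ⊇ Λ₆^{(k−1)′}` (the (2.7)–(2.8)/(2.43) tower), cube size `K₀ = M` -/

/-- **(2.67) AS PRINTED, EVERY `d`, THE COLLAR FORM, FOR PRINT'S OWN REGIONS `Λ₂^{(k−1)′} ⊇ Λ₆^{(k−1)′}`, `K₀ = M`**:
`eq267_higgs_region_collar` at `Λ₂ := Λ₂^{(j)′}`, `Λ₆ := Λ₆^{(j)′}` (`prime (towerRegion bad rad j 2)` ⊇ `… 6`), level `k = j + 1`,
cube size `M` (the `Bᵏ(Λ₂′)` big-block hypothesis discharged by own `isBigBlockUnion_towerRegion_prime`, `Λ₆′ ⊆ Λ₂′` by the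
tower's monotonicity; «`∀ M ≥ Mmin`» = print's «M sufficiently large»): `≤ C′·a_k·(Lᵏε)^κ` for every `κ`, depth coefficient
`θ > 0` (`θ = 2` print's geometry, `θ = 1/L` the `∂Λ₇′` collar). [cite: Balaban1982Higgs2, Lemma 2.4 proof (2.67) p.572, (2.78) p.574]
[cite: Balaban1982Higgs2, (2.55)–(2.56) p.570, (2.7)–(2.8) p.558, (2.43) p.566] [cite: Balaban1982Higgs1, Prop. 2.1 p.610] -/
theorem eq267_higgs_tower_collar (d L : ℕ) (hd : 1 ≤ d) (hL : 2 ≤ L) {a : ℝ} (ha : 0 < a) {msq : ℝ} (hmsq : 0 < msq)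
    (N : ℕ) (C : ChargeData N) (ε₀ : ℝ) (creg β : ℝ) (hcreg : 0 ≤ creg) (hβ : 0 < β)
    (Q : B2.Params) (hQ : Q.Printed) {lam c₁ : ℝ} (hlam : 0 < lam) (hc₁ : 0 ≤ c₁) {θ : ℝ} (hθ : 0 < θ) (s κ : ℝ) :
    ∃ Mmin : ℕ, ∀ M : ℕ, Mmin ≤ M → ∃ e₁ : ℝ, 0 < e₁ ∧ ∃ C' : ℝ,
      ∀ (P : HiggsLattice.Params), P.d = d → P.L = L → P.M = M →
      ∀ {j : ℕ}, j + 1 ≤ P.K → (∀ μ, 3 * half P (j + 1) M ≤ P.sitesPerDir 0 μ) → P.mesh (j + 1) ≤ ε₀ →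
        P.mesh (j + 1) ≤ 1 →
      ∀ (bad : (l : ℕ) → Set (HiggsLattice.Site P l)) (rad : ℕ → ℝ), 0 ≤ rad j →
      ∀ (sq₂ sq₁ : Finset (HiggsLattice.Site P (j + 1))), sq₂ ⊆ prime (towerRegion bad rad j 2) → sq₁ ⊆ sq₂ →
        sq₁ ⊆ prime (towerRegion bad rad j 6) → IsBigBlockUnion (j + 1) M (underRegion (j + 1) sq₂) →
      ∀ (A : HiggsLattice.VecField P 0) {ec : ℝ}, 0 < ec → ec ≤ e₁ →
      (∀ z ∈ underRegion (j + 1) (prime (towerRegion bad rad j 2)), ∀ μ ν : Fin P.d,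
          P.mesh (j + 1) * |C.e| / ec * |A ⟨z.shift μ, ν⟩ - A ⟨z, ν⟩| ≤ creg * ec ^ (β - 1) / (P.L : ℝ) ^ (j + 1)) →
      ∀ (x : HiggsLattice.Site P 0),
        (∀ z, HiggsLattice.Site.tdist x z ≤ 2 * rS P (j + 1) M + 2 * half P (j + 1) M * (P.d + 1) + 1 →
          z ∈ underRegion (j + 1) sq₂) →
        (θ * B2.rFn Q.R Q.r (P.mesh (j + 1)) - s) * (P.L : ℝ) ^ (j + 1) ≤ distC (underRegion (j + 1) sq₂) x →
      ∀ (φ : HiggsLattice.ScalarField P (j + 1) N),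
        (∀ y ∈ prime (towerRegion bad rad j 6),
          ‖φ y‖ ≤ c₁ * B2LargeField.thrPhi lam (P.mesh (j + 1) / Q.L) d (B2.pFn Q.b₀ Q.p (P.mesh (j + 1) / Q.L))) →
        (∀ y ∈ prime (towerRegion bad rad j 6), y ∉ sq₁ →
          2 * B2.rFn Q.R Q.r (P.mesh (j + 1)) - s ≤ (HiggsLattice.Site.tdist (blockIter (j + 1) x) y : ℝ)) →
        ‖bgScalar256 C msq a (j + 1) (prime (towerRegion bad rad j 2)) (prime (towerRegion bad rad j 6)) A φ x
            - bgScalar256 C msq a (j + 1) sq₂ sq₁ A φ x‖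
          ≤ C' * B1.aSeq a P.L (j + 1) * P.mesh (j + 1) ^ κ := by
  obtain ⟨K₀min, h⟩ := eq267_higgs_region_collar d L hd hL ha hmsq N C ε₀ creg β hcreg hβ Q hQ hlam hc₁ hθ s κ
  refine ⟨K₀min, fun M hM => ?_⟩
  obtain ⟨e₁, he₁, C', h1⟩ := h M hM
  refine ⟨e₁, he₁, C', ?_⟩
  intro P hPd hPL hPM j hk hsz hε hℓ1 bad rad hrad sq₂ sq₁ hs2 hs12 hs16 hsq A ec hec hle hreg x hx hdist φ hφ hfar
  have hdvd : M ∣ P.M := hPM ▸ dvd_refl _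
  have hΩ : IsBigBlockUnion (j + 1) M (underRegion (j + 1) (prime (towerRegion bad rad j 2))) :=
    hPM ▸ isBigBlockUnion_towerRegion_prime bad rad j 2
  exact h1 P hPd hPL hdvd (Nat.succ_le_succ (Nat.zero_le j)) hk hsz hε hℓ1 _ _ sq₂ sq₁
    (prime_towerRegion_six_subset_two bad hrad) hs2 hs12 hs16 hΩ hsq A hec hle hreg x hx hdist φ hφ hfar

/-- **(2.67), COVARIANT-DERIVATIVE FORM, AS PRINTED, EVERY `d`, THE COLLAR FORM, FOR PRINT'S OWN REGIONS, `K₀ = M`**: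
`eq267_deriv_higgs_region_collar` at `Λ₂ := Λ₂^{(j)′}`, `Λ₆ := Λ₆^{(j)′}`, `k = j + 1`, cube size `M` — `≤ C′·a_k·(Lᵏε)^κ`.
[cite: Balaban1982Higgs2, Lemma 2.4 proof (2.67) p.572 «and the same equality for the covariant derivative of φ^{(k)}», (2.78) p.574]
[cite: Balaban1982Higgs2, (2.55)–(2.56) p.570, (2.7)–(2.8) p.558] [cite: Balaban1982Higgs1, Prop. 2.1 p.610] -/
theorem eq267_deriv_higgs_tower_collar (d L : ℕ) (hd : 1 ≤ d) (hL : 2 ≤ L) {a : ℝ} (ha : 0 < a) {msq : ℝ}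
    (hmsq : 0 < msq) (N : ℕ) (C : ChargeData N) (ε₀ : ℝ) (creg β : ℝ) (hcreg : 0 ≤ creg) (hβ : 0 < β)
    (Q : B2.Params) (hQ : Q.Printed) {lam c₁ : ℝ} (hlam : 0 < lam) (hc₁ : 0 ≤ c₁) {θ : ℝ} (hθ : 0 < θ) (s κ : ℝ) :
    ∃ Mmin : ℕ, ∀ M : ℕ, Mmin ≤ M → ∃ e₁ : ℝ, 0 < e₁ ∧ ∃ C' : ℝ,
      ∀ (P : HiggsLattice.Params), P.d = d → P.L = L → P.M = M →
      ∀ {j : ℕ}, j + 1 ≤ P.K → (∀ μ, 3 * half P (j + 1) M ≤ P.sitesPerDir 0 μ) → P.mesh (j + 1) ≤ ε₀ →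
        P.mesh (j + 1) ≤ 1 →
      ∀ (bad : (l : ℕ) → Set (HiggsLattice.Site P l)) (rad : ℕ → ℝ), 0 ≤ rad j →
      ∀ (sq₂ sq₁ : Finset (HiggsLattice.Site P (j + 1))), sq₂ ⊆ prime (towerRegion bad rad j 2) → sq₁ ⊆ sq₂ →
        sq₁ ⊆ prime (towerRegion bad rad j 6) → IsBigBlockUnion (j + 1) M (underRegion (j + 1) sq₂) →
      ∀ (A : HiggsLattice.VecField P 0) {ec : ℝ}, 0 < ec → ec ≤ e₁ →
      (∀ z ∈ underRegion (j + 1) (prime (towerRegion bad rad j 2)), ∀ μ ν : Fin P.d,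
          P.mesh (j + 1) * |C.e| / ec * |A ⟨z.shift μ, ν⟩ - A ⟨z, ν⟩| ≤ creg * ec ^ (β - 1) / (P.L : ℝ) ^ (j + 1)) →
      ∀ (x : HiggsLattice.Site P 0) (μ : Fin P.d),
        (∀ z, HiggsLattice.Site.tdist x z ≤ 2 * rS P (j + 1) M + 2 * half P (j + 1) M * (P.d + 1) + 1 →
          z ∈ underRegion (j + 1) sq₂) →
        (θ * B2.rFn Q.R Q.r (P.mesh (j + 1)) - s) * (P.L : ℝ) ^ (j + 1) ≤ distC (underRegion (j + 1) sq₂) x →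
      ∀ (φ : HiggsLattice.ScalarField P (j + 1) N),
        (∀ y ∈ prime (towerRegion bad rad j 6),
          ‖φ y‖ ≤ c₁ * B2LargeField.thrPhi lam (P.mesh (j + 1) / Q.L) d (B2.pFn Q.b₀ Q.p (P.mesh (j + 1) / Q.L))) →
        (∀ y ∈ prime (towerRegion bad rad j 6), y ∉ sq₁ →
          2 * B2.rFn Q.R Q.r (P.mesh (j + 1)) - s ≤ (HiggsLattice.Site.tdist (blockIter (j + 1) x) y : ℝ)) →
        ‖covDeriv C A (bgScalar256 C msq a (j + 1) (prime (towerRegion bad rad j 2)) (prime (towerRegion bad rad j 6)) A φ)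
              ⟨x, μ⟩
            - covDeriv C A (bgScalar256 C msq a (j + 1) sq₂ sq₁ A φ) ⟨x, μ⟩‖
          ≤ C' * B1.aSeq a P.L (j + 1) * P.mesh (j + 1) ^ κ := by
  obtain ⟨K₀min, h⟩ := eq267_deriv_higgs_region_collar d L hd hL ha hmsq N C ε₀ creg β hcreg hβ Q hQ hlam hc₁ hθ s κ
  refine ⟨K₀min, fun M hM => ?_⟩
  obtain ⟨e₁, he₁, C', h1⟩ := h M hM
  refine ⟨e₁, he₁, C', ?_⟩
  intro P hPd hPL hPM j hk hsz hε hℓ1 bad rad hrad sq₂ sq₁ hs2 hs12 hs16 hsq A ec hec hle hreg x μ hx hdist φ hφ hfar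
  have hdvd : M ∣ P.M := hPM ▸ dvd_refl _
  have hΩ : IsBigBlockUnion (j + 1) M (underRegion (j + 1) (prime (towerRegion bad rad j 2))) :=
    hPM ▸ isBigBlockUnion_towerRegion_prime bad rad j 2
  exact h1 P hPd hPL hdvd (Nat.succ_le_succ (Nat.zero_le j)) hk hsz hε hℓ1 _ _ sq₂ sq₁
    (prime_towerRegion_six_subset_two bad hrad) hs2 hs12 hs16 hΩ hsq A hec hle hreg x μ hx hdist φ hφ hfar

end

end Literature.MathematicalPhysics.QuantumFieldTheory.Balaban1983to89.B2Eq267HiggsRegionAsPrinted
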